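import Summits.QuantumFields.YangMills.Theorems.UnitScaleTiltFluctuationComparisonRegPrPrintChiWindow
import HarnessLib

/-!
# `UnitScaleTiltFluctuationComparisonRegPrPrintChiEdgeVacuous` — STUB 4′ of crux `FluctuationComparisonRegPrL` (stmt-QuantumFields-19935), (R1) «print's χ back», part 10:
# WHERE THE WHOLE WINDOW IS χ-GOOD, THE EDGE STUB (ii)* IS A THEOREM — pigeonhole for its frequently-clause (no measurability of the two-run quantity needed), vacuity of
# its first clause, and the whole-window χ-goodness at every cut-off from part 9 (given [7] Thm 1 and `2B₃ ≤ (1−μ)·L√L`)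

Cell `ym3-torus`, width-lever lane `ym-ust-19935-r1`; parts 1–9 landed (p528527 … p533343).  Count-neutral helper (`--supports stmt-QuantumFields-19935`).  Pure measure theory and
bookkeeping; NO numerics; nothing of [Balaban1985UV3]/[King1986] is asserted; [Balaban1985Variational] Thm 1 enters as the schema `Thm1GlobalMinAt` (crux `MinimiserStabilityRegPr`'s currency).

* §1 `exists_const_frequently_abs_sub_le` — PIGEONHOLE IN THE a.e. FILTER: if `P` holds on a non-null set then for every `r > 0` some constant `c` has `P ∧ |Δ − c| ≤ r` on a non-null
  set, for an ARBITRARY real function `Δ` (slabs `Δ ∈ [jr, (j+1)r)`, `j ∈ ℤ`; countable subadditivity of the outer measure).  So the «attained on a non-null part» clause of the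
  edge stub costs nothing beyond non-nullness of the doubly-χ-good positive window set.
* §2 `edgeOffChi_of_forall_chiGood` — per family: if at every cut-off EVERY window datum is χ-good for both runs, and the window data with both densities positive form a
  non-null set, then the (ii)-body holds at that margin with `r′_K = 2^{−K}` (first clause vacuous, second by §1).
* §3 `forall_window_chiGood_of_thm1GlobalMinAt` — the hypothesis of §2 from part 9 (`chiGood_of_window_of_thm1GlobalMinAt` for `n < K`, `chiGood_top` at `K = 0`), given
  `Thm1GlobalMinAt L a₀ a₁ B₃`, the standing thresholds at every height, Prop 2's smallness, `m ≥ 2` and the floor `2B₃ ≤ (1−μ)·L√L`;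
  `edgeOffChi_of_thm1GlobalMinAt` — §2 ∘ §3.
CONSEQUENCE (letters): at every block size with `L√L > 2B₃` (B₃ = [7]'s minimiser gain; ≈ 4–4.3 ⇒ L ≥ 5) the edge stub (ii)* of RULING g21-№4 is dischargeable from [7] Thm 1 +
a.e. positivity on the window (STUB 1's currency) + non-nullness of the window; 4′ there ⇐ 2′ ∧ (i)* ∧ those.  At L = 3 (`3√3 < 2B₃`) the edge set is genuine (FINDING #44).

References: T. Bałaban, CMP 102 (1985) 277–309 [Balaban1985Variational] (Thm 1 (8) p.279); C. King, CMP 102 (1986) 649–677 [King1986] (Prop. 3.8–3.9 pp.664–665).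
-/

noncomputable section

namespace Summit.QuantumFields.YangMills.Theorems.PrintChi

open MeasureTheory Filter
open Literature.MathematicalPhysics.QuantumFieldTheory.Balaban1983to89
open Literature.MathematicalPhysics.QuantumFieldTheory.Balaban1983to89.T3ContinuumYM3Torus
open Literature.MathematicalPhysics.QuantumFieldTheory.Balaban1983to89.T3UnitLawDensityEML (ℰp measurableE_ℰp)
open Literature.MathematicalPhysics.QuantumFieldTheory.Balaban1983to89.T3UnitScaleTilt
open Literature.MathematicalPhysics.QuantumFieldTheory.Balaban1983to89.T3TiltDescent
open Literature.MathematicalPhysics.QuantumFieldTheory.Balaban1983to89.T3PrintedRegularMinimiser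
open Literature.MathematicalPhysics.QuantumFieldTheory.Balaban1983to89.T3PrintedMinimiserExistence
open Literature.MathematicalPhysics.QuantumFieldTheory.Balaban1983to89.ExpMeanLog (deltaSU deltaSU_pos)

/-! ## §1 Pigeonhole in the a.e. filter -/

section Pigeonhole

variable {X : Type*} [MeasurableSpace X] {μ : Measure X}

/-- **PIGEONHOLE IN THE a.e. FILTER**: if `P` holds μ-frequently (on a non-null set) then for every `r > 0` there is a constant `c` with `P x ∧ |Δ x − c| ≤ r` μ-frequently — for an
ARBITRARY function `Δ : X → ℝ` (no measurability): the slabs `{Δ ∈ [jr, (j+1)r)}`, `j ∈ ℤ`, cover `X`, and a countable union of null sets is null (outer measure). [folklore] -/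
theorem exists_const_frequently_abs_sub_le {P : X → Prop} {Δ : X → ℝ} (hP : ∃ᵐ x ∂μ, P x) {r : ℝ} (hr : 0 < r) :
    ∃ c : ℝ, ∃ᵐ x ∂μ, P x ∧ |Δ x - c| ≤ r := by
  by_contra hcon
  -- every slab is null
  have hslab : ∀ j : ℤ, ∀ᵐ x ∂μ, ¬ (P x ∧ |Δ x - ((j : ℝ) * r + r / 2)| ≤ r) := fun j => by
    have h : ¬ ∃ᵐ x ∂μ, P x ∧ |Δ x - ((j : ℝ) * r + r / 2)| ≤ r := fun h => hcon ⟨_, h⟩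
    rwa [Filter.not_frequently] at h
  have hall : ∀ᵐ x ∂μ, ∀ j : ℤ, ¬ (P x ∧ |Δ x - ((j : ℝ) * r + r / 2)| ≤ r) := ae_all_iff.mpr hslab
  -- but every point lies in the slab `j = ⌊Δ x / r⌋`, within `r/2 ≤ r` of its centre
  refine hP (hall.mono fun x hx hPx => ?_)
  refine hx ⌊Δ x / r⌋ ⟨hPx, ?_⟩
  have h1 : (⌊Δ x / r⌋ : ℝ) ≤ Δ x / r := Int.floor_le _
  have h2 : Δ x / r < ⌊Δ x / r⌋ + 1 := Int.lt_floor_add_one _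
  have h1' : (⌊Δ x / r⌋ : ℝ) * r ≤ Δ x := by rwa [le_div_iff₀ hr] at h1
  have h2' : Δ x < ((⌊Δ x / r⌋ : ℝ) + 1) * r := by rwa [div_lt_iff₀ hr] at h2
  rw [abs_le]
  constructor <;> linarith

end Pigeonhole

/-! ## §2 Per family: whole-window χ-goodness makes the edge body vacuous -/

section Vacuous

variable (F : T3Family) (γ b₀ p₀ ε₀ μ : ℝ) (m : ℕ)

/-- **THE EDGE BODY IS A THEOREM WHERE EVERY WINDOW DATUM IS DOUBLY χ-GOOD.**  If at every cut-off `K` every `θ(⌊K/m⌋)`-window datum is χ-good for run `K` AND run `K+1` (margin `μ`),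
and the window data at which both restricted densities are positive form a NON-NULL set, then the (ii)-body of the edge stub holds at `μ` with radii `r′_K = 2^{−K}`: its first
clause is vacuous (no window datum is off χ), its frequently-clause is §1's pigeonhole.  No estimate enters. [cite: King1986, Prop. 3.8-3.9 pp.664-665] -/
theorem edgeOffChi_of_forall_chiGood
    (hall : ∀ (K : ℕ) (V : GaugeField (F.P (K / m)) 0 (Matrix.specialUnitaryGroup (Fin 2) ℂ)), PlaqSmall (θBal F.L γ b₀ p₀ (K / m)) V →
      ChiGood F γ b₀ p₀ ε₀ μ (Nat.div_le_self K m) V ∧ ChiGood F γ b₀ p₀ ε₀ μ ((Nat.div_le_self K m).trans (Nat.le_succ K)) V)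
    (hpos : ∀ K, ∃ᵐ V ∂fieldMeasure (F.P (K / m)) 0 (Matrix.specialUnitaryGroup (Fin 2) ℂ),
      PlaqSmall (θBal F.L γ b₀ p₀ (K / m)) V ∧
        0 < heightDensity F γ (Nat.div_le_self K m) (histGood F ℰp (θBal F.L γ b₀ p₀) K (K / m)) V ∧
        0 < heightDensity F γ ((Nat.div_le_self K m).trans (Nat.le_succ K)) (histGood F ℰp (θBal F.L γ b₀ p₀) (K + 1) (K / m)) V) :
    ∃ r' : ℕ → ℝ, Summable r' ∧ (∀ K, 0 ≤ r' K) ∧ ∀ K, ∃ c : ℝ,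
      (∀ᵐ V ∂fieldMeasure (F.P (K / m)) 0 (Matrix.specialUnitaryGroup (Fin 2) ℂ),
        PlaqSmall (θBal F.L γ b₀ p₀ (K / m)) V →
          ¬ (ChiGood F γ b₀ p₀ ε₀ μ (Nat.div_le_self K m) V ∧
              ChiGood F γ b₀ p₀ ε₀ μ ((Nat.div_le_self K m).trans (Nat.le_succ K)) V) →
          0 < heightDensity F γ (Nat.div_le_self K m) (histGood F ℰp (θBal F.L γ b₀ p₀) K (K / m)) V →
          0 < heightDensity F γ ((Nat.div_le_self K m).trans (Nat.le_succ K))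
                (histGood F ℰp (θBal F.L γ b₀ p₀) (K + 1) (K / m)) V →
            |(Real.log (heightDensity F γ ((Nat.div_le_self K m).trans (Nat.le_succ K))
                  (histGood F ℰp (θBal F.L γ b₀ p₀) (K + 1) (K / m)) V) + bgRegPr' F γ m ε₀ K V) -
              (Real.log (heightDensity F γ (Nat.div_le_self K m) (histGood F ℰp (θBal F.L γ b₀ p₀) K (K / m)) V) + bgRegPr F γ m ε₀ K V) -
                c| ≤ r' K) ∧
      (∃ᵐ V ∂fieldMeasure (F.P (K / m)) 0 (Matrix.specialUnitaryGroup (Fin 2) ℂ),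
        (PlaqSmall (θBal F.L γ b₀ p₀ (K / m)) V ∧
          ChiGood F γ b₀ p₀ ε₀ μ (Nat.div_le_self K m) V ∧
          ChiGood F γ b₀ p₀ ε₀ μ ((Nat.div_le_self K m).trans (Nat.le_succ K)) V) ∧
          0 < heightDensity F γ (Nat.div_le_self K m) (histGood F ℰp (θBal F.L γ b₀ p₀) K (K / m)) V ∧
          0 < heightDensity F γ ((Nat.div_le_self K m).trans (Nat.le_succ K))
                (histGood F ℰp (θBal F.L γ b₀ p₀) (K + 1) (K / m)) V ∧
            |(Real.log (heightDensity F γ ((Nat.div_le_self K m).trans (Nat.le_succ K))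
                  (histGood F ℰp (θBal F.L γ b₀ p₀) (K + 1) (K / m)) V) + bgRegPr' F γ m ε₀ K V) -
              (Real.log (heightDensity F γ (Nat.div_le_self K m) (histGood F ℰp (θBal F.L γ b₀ p₀) K (K / m)) V) + bgRegPr F γ m ε₀ K V) -
                c| ≤ r' K) := by
  refine ⟨fun K => (1 / 2 : ℝ) ^ K, summable_geometric_of_lt_one (by norm_num) (by norm_num), fun K => by positivity, fun K => ?_⟩
  have hr : (0 : ℝ) < (1 / 2 : ℝ) ^ K := by positivity
  obtain ⟨c, hc⟩ := exists_const_frequently_abs_sub_le (μ := fieldMeasure (F.P (K / m)) 0 (Matrix.specialUnitaryGroup (Fin 2) ℂ))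
    (Δ := fun V => (Real.log (heightDensity F γ ((Nat.div_le_self K m).trans (Nat.le_succ K))
        (histGood F ℰp (θBal F.L γ b₀ p₀) (K + 1) (K / m)) V) + bgRegPr' F γ m ε₀ K V) -
      (Real.log (heightDensity F γ (Nat.div_le_self K m) (histGood F ℰp (θBal F.L γ b₀ p₀) K (K / m)) V) + bgRegPr F γ m ε₀ K V))
    (hpos K) hr
  refine ⟨c, ae_of_all _ fun V hs hnot _ _ => (hnot (hall K V hs)).elim, ?_⟩
  refine hc.mono fun V hV => ?_
  obtain ⟨⟨hs, h0, h0'⟩, hΔ⟩ := hV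
  exact ⟨⟨hs, (hall K V hs).1, (hall K V hs).2⟩, h0, h0', hΔ⟩

end Vacuous

/-! ## §3 The whole window is doubly χ-good at every cut-off, given [7] Thm 1 and the floor `2B₃ ≤ (1−μ)·L√L` -/

section Whole

variable (F : T3Family) {γ b₀ p₀ ε₀ μ : ℝ}

/-- **AT EVERY CUT-OFF, EVERY WINDOW DATUM IS χ-GOOD FOR BOTH RUNS**, given: `Thm1GlobalMinAt L a₀ a₁ B₃` ([7] Thm 1, global reading), the standing thresholds at every height
(`θ(n) ≤ a₁`, `B₃θ(n) ≤ ε₀`, `4θ(n) < ε₀`; `ε₀ ≤ a₀`), Prop 2's smallness of `B₃θ(n)`, `m ≥ 2`, `μ < 1` and the floor `2B₃ ≤ (1−μ)·L√L`: run `K+1` and run `K ≥ 1` by part 9's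
`chiGood_of_window_of_thm1GlobalMinAt` (`⌊K/m⌋ < K`), run `K = 0` by `chiGood_top`. [cite: Balaban1985Variational, Thm 1 (8) p.279] -/
theorem forall_window_chiGood_of_thm1GlobalMinAt (hγ : 0 < γ) (hγ1 : γ ≤ 1) (hb : 0 < b₀) (hp : 0 ≤ p₀) (hμ : μ < 1)
    {a₀ a₁ B₃ : ℝ} (hB₃ : 0 < B₃) (hT : Thm1GlobalMinAt F.L a₀ a₁ B₃) {m : ℕ} (hm : 2 ≤ m) (hhi : ε₀ ≤ a₀)
    (hthr : ∀ n, θBal F.L γ b₀ p₀ n ≤ a₁ ∧ B₃ * θBal F.L γ b₀ p₀ n ≤ ε₀ ∧ 4 * θBal F.L γ b₀ p₀ n < ε₀)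
    (hsm : ∀ n, (143 * ((((3 + 4 : ℕ) : ℝ)) ^ 2 / 4) ^ 2) * (B₃ * θBal F.L γ b₀ p₀ n) ≤ 1 / 3 ∧
      2 * (B₃ * θBal F.L γ b₀ p₀ n) ≤ 2 * deltaSU (Fin 2) / (((3 + 4) * F.L : ℕ) : ℝ) ^ 2)
    (hfloor : 2 * B₃ ≤ (1 - μ) * ((F.L : ℝ) * Real.sqrt F.L)) :
    ∀ (K : ℕ) (V : GaugeField (F.P (K / m)) 0 (Matrix.specialUnitaryGroup (Fin 2) ℂ)), PlaqSmall (θBal F.L γ b₀ p₀ (K / m)) V →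
      ChiGood F γ b₀ p₀ ε₀ μ (Nat.div_le_self K m) V ∧ ChiGood F γ b₀ p₀ ε₀ μ ((Nat.div_le_self K m).trans (Nat.le_succ K)) V := by
  intro K V hV
  have hθ : 0 < θBal F.L γ b₀ p₀ (K / m) := T3MinimiserStabilityReduction.θBal_pos F.hL.2.le hγ hγ1 hb p₀ (K / m)
  obtain ⟨ha₁, hlo, h4⟩ := hthr (K / m)
  obtain ⟨hs3, hs2⟩ := hsm (K / m)
  have hlt' : K / m < K + 1 := Nat.lt_succ_of_le (Nat.div_le_self K m)
  refine ⟨?_, chiGood_of_window_of_thm1GlobalMinAt hγ hγ1 hb hp hμ hB₃ hT hlt' ha₁ hlo hhi hs3 hs2 hfloor hV⟩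
  rcases Nat.eq_zero_or_pos K with hK0 | hKpos
  · subst hK0
    -- top height: `0 / m = 0`
    have h0 : 0 / m = 0 := Nat.zero_div m
    have key : ∀ (n : ℕ) (hn : n ≤ 0) (W : GaugeField (F.P n) 0 (Matrix.specialUnitaryGroup (Fin 2) ℂ)),
        PlaqSmall (θBal F.L γ b₀ p₀ n) W → 4 * θBal F.L γ b₀ p₀ n < ε₀ → ChiGood F γ b₀ p₀ ε₀ μ hn W := by
      intro n hn W hW h4W
      obtain rfl : n = 0 := Nat.le_zero.mp hn
      have hθ0 : 0 < θBal F.L γ b₀ p₀ 0 := T3MinimiserStabilityReduction.θBal_pos F.hL.2.le hγ hγ1 hb p₀ 0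
      exact chiGood_top hW (by linarith) h4W
    exact key (0 / m) (Nat.div_le_self 0 m) V hV h4
  · have hlt : K / m < K := by
      have h1 : K / m ≤ K / 2 := Nat.div_le_div_left hm (by norm_num)
      omega
    exact chiGood_of_window_of_thm1GlobalMinAt hγ hγ1 hb hp hμ hB₃ hT hlt ha₁ hlo hhi hs3 hs2 hfloor hV

/-- **THE EDGE BODY FROM [7] THM 1 BELOW THE FLOOR** (§2 ∘ §3): given `Thm1GlobalMinAt L a₀ a₁ B₃`, the standing thresholds and Prop 2's smallness at every height, `m ≥ 2`,
`μ < 1`, `2B₃ ≤ (1−μ)·L√L`, and non-nullness of the doubly-positive window data at every cut-off, the (ii)-body of the edge stub holds at margin `μ` — at such block sizes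
the (R1) edge clause is NOT new mathematics. [cite: Balaban1985Variational, Thm 1 (8) p.279] -/
theorem edgeOffChi_of_thm1GlobalMinAt (hγ : 0 < γ) (hγ1 : γ ≤ 1) (hb : 0 < b₀) (hp : 0 ≤ p₀) (hμ : μ < 1)
    {a₀ a₁ B₃ : ℝ} (hB₃ : 0 < B₃) (hT : Thm1GlobalMinAt F.L a₀ a₁ B₃) {m : ℕ} (hm : 2 ≤ m) (hhi : ε₀ ≤ a₀)
    (hthr : ∀ n, θBal F.L γ b₀ p₀ n ≤ a₁ ∧ B₃ * θBal F.L γ b₀ p₀ n ≤ ε₀ ∧ 4 * θBal F.L γ b₀ p₀ n < ε₀)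
    (hsm : ∀ n, (143 * ((((3 + 4 : ℕ) : ℝ)) ^ 2 / 4) ^ 2) * (B₃ * θBal F.L γ b₀ p₀ n) ≤ 1 / 3 ∧
      2 * (B₃ * θBal F.L γ b₀ p₀ n) ≤ 2 * deltaSU (Fin 2) / (((3 + 4) * F.L : ℕ) : ℝ) ^ 2)
    (hfloor : 2 * B₃ ≤ (1 - μ) * ((F.L : ℝ) * Real.sqrt F.L))
    (hpos : ∀ K, ∃ᵐ V ∂fieldMeasure (F.P (K / m)) 0 (Matrix.specialUnitaryGroup (Fin 2) ℂ),
      PlaqSmall (θBal F.L γ b₀ p₀ (K / m)) V ∧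
        0 < heightDensity F γ (Nat.div_le_self K m) (histGood F ℰp (θBal F.L γ b₀ p₀) K (K / m)) V ∧
        0 < heightDensity F γ ((Nat.div_le_self K m).trans (Nat.le_succ K)) (histGood F ℰp (θBal F.L γ b₀ p₀) (K + 1) (K / m)) V) :
    ∃ r' : ℕ → ℝ, Summable r' ∧ (∀ K, 0 ≤ r' K) ∧ ∀ K, ∃ c : ℝ,
      (∀ᵐ V ∂fieldMeasure (F.P (K / m)) 0 (Matrix.specialUnitaryGroup (Fin 2) ℂ),
        PlaqSmall (θBal F.L γ b₀ p₀ (K / m)) V →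
          ¬ (ChiGood F γ b₀ p₀ ε₀ μ (Nat.div_le_self K m) V ∧
              ChiGood F γ b₀ p₀ ε₀ μ ((Nat.div_le_self K m).trans (Nat.le_succ K)) V) →
          0 < heightDensity F γ (Nat.div_le_self K m) (histGood F ℰp (θBal F.L γ b₀ p₀) K (K / m)) V →
          0 < heightDensity F γ ((Nat.div_le_self K m).trans (Nat.le_succ K))
                (histGood F ℰp (θBal F.L γ b₀ p₀) (K + 1) (K / m)) V →
            |(Real.log (heightDensity F γ ((Nat.div_le_self K m).trans (Nat.le_succ K))
                  (histGood F ℰp (θBal F.L γ b₀ p₀) (K + 1) (K / m)) V) + bgRegPr' F γ m ε₀ K V) -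
              (Real.log (heightDensity F γ (Nat.div_le_self K m) (histGood F ℰp (θBal F.L γ b₀ p₀) K (K / m)) V) + bgRegPr F γ m ε₀ K V) -
                c| ≤ r' K) ∧
      (∃ᵐ V ∂fieldMeasure (F.P (K / m)) 0 (Matrix.specialUnitaryGroup (Fin 2) ℂ),
        (PlaqSmall (θBal F.L γ b₀ p₀ (K / m)) V ∧
          ChiGood F γ b₀ p₀ ε₀ μ (Nat.div_le_self K m) V ∧
          ChiGood F γ b₀ p₀ ε₀ μ ((Nat.div_le_self K m).trans (Nat.le_succ K)) V) ∧
          0 < heightDensity F γ (Nat.div_le_self K m) (histGood F ℰp (θBal F.L γ b₀ p₀) K (K / m)) V ∧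
          0 < heightDensity F γ ((Nat.div_le_self K m).trans (Nat.le_succ K))
                (histGood F ℰp (θBal F.L γ b₀ p₀) (K + 1) (K / m)) V ∧
            |(Real.log (heightDensity F γ ((Nat.div_le_self K m).trans (Nat.le_succ K))
                  (histGood F ℰp (θBal F.L γ b₀ p₀) (K + 1) (K / m)) V) + bgRegPr' F γ m ε₀ K V) -
              (Real.log (heightDensity F γ (Nat.div_le_self K m) (histGood F ℰp (θBal F.L γ b₀ p₀) K (K / m)) V) + bgRegPr F γ m ε₀ K V) -
                c| ≤ r' K) :=
  edgeOffChi_of_forall_chiGood F γ b₀ p₀ ε₀ μ m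
    (forall_window_chiGood_of_thm1GlobalMinAt F hγ hγ1 hb hp hμ hB₃ hT hm hhi hthr hsm hfloor) hpos

end Whole

end Summit.QuantumFields.YangMills.Theorems.PrintChi

end
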